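import Summits.CriticalPhenomena.PercolationContinuityZ3.Theorems.Transplant.SkelPhiFaceRegionNbT
import Summits.CriticalPhenomena.PercolationContinuityZ3.Theorems.Transplant.SkelPhiFaceRegionNb
import Summits.CriticalPhenomena.PercolationContinuityZ3.Theorems.Transplant.SkelPhiFaceStepNT
import Summits.CriticalPhenomena.PercolationContinuityZ3.Theorems.Transplant.SkelPhiFaceStepN
import Summits.CriticalPhenomena.PercolationContinuityZ3.Theorems.Transplant.SkelPhiConcFaceStep
import Summits.CriticalPhenomena.PercolationContinuityZ3.Theorems.Transplant.SkelPhiFaceStepNb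
import Literature.Probability.Percolation.OrientedHistorySiteRenormalizationRun
import Summits.CriticalPhenomena.PercolationContinuityZ3.Theorems.Transplant.SkelPhiCellsSmallMT
import Summits.CriticalPhenomena.PercolationContinuityZ3.Theorems.Transplant.SkelPhiCellsWeakGT
import Summits.CriticalPhenomena.PercolationContinuityZ3.Theorems.Transplant.KNCells2CoverO
import Summits.CriticalPhenomena.PercolationContinuityZ3.Theorems.Transplant.KNCells2SchemeO
import Summits.CriticalPhenomena.PercolationContinuityZ3.Theorems.Transplant.KNCells2SepQO
import Summits.CriticalPhenomena.PercolationContinuityZ3.Theorems.Transplant.KNCellsSchemeO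
import Summits.CriticalPhenomena.PercolationContinuityZ3.Theorems.Transplant.PlanarCells2TArm
import Summits.CriticalPhenomena.PercolationContinuityZ3.Theorems.Transplant.PlanarCells2TDefs
import Summits.CriticalPhenomena.PercolationContinuityZ3.Theorems.Transplant.PlanarCells2SepT
import Summits.CriticalPhenomena.PercolationContinuityZ3.Theorems.Transplant.SkelTubeSubO
import HarnessLib
/-!
(R-40) SUCCESSOR `…T` (hp-8 g42, 2026-08-23; ruling p3-g16 06:23:56Z, J18): the twin of `SkelPhiFaceStepNbS` over the PER-AXIS creep cap `PCells2T` (PlanarCells2TDefs: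
`c i ≤ r (oth i)` instead of the uniform `c i ≤ cmax ≤ r j`); statements and proofs VERBATIM with `PCells2S ↦ PCells2T` (+ the renames of record of the T layer below it);
the only mathematical touch points are the places that read the cap, which only ever need the cross form `c (oth j) ≤ r j` (listed in the lane line of this file's landing).
NO landed file is edited; `SkelPhiFaceStepNbS` stays valid (and is an instance of this file through `PCells2S.toT`). NON-VACUITY: inherited verbatim from `SkelPhiFaceStepNbS` (same witness line).

# N2 (frames-only node `SamePDropOfSkeletonFrm₁`, OPEN) — WAVE 1, (F) face-data column over STAGGERED cells ((R-22) `PCells2T`, (R-28)(β) one landing per file): the twin of N1's `SkelPhiFaceStepNb`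

builds on p205010 (kernel theorem, internal audit signed; external expert review pending) — nothing in this file uses p205010; NOTHING is claimed about the
open node `SamePDropOfSkeletonFrm₁` (`SamePDropOfSkeletonNeg₁` is CLOSED in the tree and untouched by this file).
Status sentence (coordinator 2026-08-20T04:30Z): "θ(p_c) = 0 on ℤ^d, all d ≥ 2 — kernel-verified (Lean 4/Mathlib, standard axioms); internal adversarial
audit SIGNED 2026-08-20 04:29Z; external expert review pending."
Lane `prim-bschramm`, seat `prim-hp-8` (gen 40); helper file (`--supports stmt-CriticalPhenomena-4575 --as helper`); design owner p3-g15 ((R-22) staggered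
cells `PCells2T`, (R-27)/(R-29) far regions of record `FarNS/FarNS₂`, (R-28)(β), naming 2026-08-22T23:00:04Z: suffix `S`).
PORT RULES (HOME/prim-hp-8/code/gen40/orient/bin/port_s.py = stmt-g19's port_orient.py + the G token table): the cells are `P : PCells2T`, every box is
read about the STAGGERED centre `cenS` (`PlanarCells2SDefs/SFar/ContainS/SArm/SepS/SepInfS/LevelsS/EfarN2S`), the scheme record is `cellGeomSG₂T`/`cellGeomSG₂bT`
(`SkelPhiCellsWeakGS/…SmallMS`: narrow arm `BtwNS`, two-block far region `FarNS₂`), the history-site API is the ORIENTED one at `qNE` where it occurs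
(`ochoice qNE`, `onwardO`, `Valid₂O`, `IsRun₂O`, …, (R-18)); EVERY declaration is re-declared with the suffix `S` (same namespace). Docstrings/citations are N1's.
N1 HEADER (kept for the reader):
* §1 `Efar₂_disjoint_Ewv'b`, **`isSubbox_Wt_fresh₂b`**, **`isSubbox_Wt_sub₂b`**, `sub_subset_Sx₂b`, `root_not_mem_sub₂b`;
* §2 **`entrance_faceFresh₂b`**, **`rim_excess_sub₂b`**.
[cite: KozmaNitzan2024, §4 p. 27 ((30)), p. 30 (Step III), p. 31 (D is a subbox of Ω), Lemma 12 (p. 24)] [cite: MartineauSevero2019, Cor. 2.2]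
-/
noncomputable section

open MeasureTheory
open scoped Classical

namespace Summit.CriticalPhenomena.PercolationContinuityZ3.Theorems.Transplant

namespace Skelφ

open Literature.Probability.Percolation Literature.Probability.LatticeModels SimpleGraph KNCells KNLevels GadgetSystem Contour
open Literature.Probability.Percolation.KozmaNitzan
open Literature.Probability.Percolation.KozmaNitzan.Cells (oth oth_ne sgOf sgOf_sign stepVec_apply_fst stepVec_apply_oth eq_oth_of_ne oth_oth)
open Literature.Barriers.CriticalPhenomena (graphBall graphBall_finite mem_graphBall_self graphBall_mono)
open BoxProdZ2 (ConcRadiiG mem_graphBall_succ_of_adj)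
open Skel (winGraph excess)

variable {V : Type} [DecidableEq V] {G : SimpleGraph V} [G.LocallyFinite] {ψ : V → Site 2}
variable {P : PCells2T} {w₀ : V} {Λ : ConcRadiiG} {b₀ : Fin 2 → ℕ} {p : unitInterval} {δc : ℝ}

variable (hΛ : WFS2 P.toPCells2 Λ) (hb₀ : ∀ i, b₀ i ≤ 3 * P.r i)
variable {h : ProbeHistory V} {e : Site 2 × MDir} (hV : (⟨cellGeomSG₂bT G ψ P w₀ Λ b₀, p, δc⟩ : KSchA V ℕ).Valid₂O G h e) {a a' : ℕ} {du : MDir} (hdu : du ∈ (⟨cellGeomSG₂bT G ψ P w₀ Λ b₀, p, δc⟩ : KSchA V ℕ).onwardO G h (tgt e))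
variable {j : ℕ} {o : Finset (Sym2 V)}

/-! ## §1 The subbox facts of the face step, for every sub-region of the cell-map window -/

/-- `E^far_{a'}(w + δw, du)` (slack far region) misses `E_{w,v}` of the incoming edge when `du` is not the way back. [cite: KozmaNitzan2024, §4 p. 26] -/
theorem Efar₂_disjoint_Ewv'bT (a a' : ℕ) (w : Site 2) {δw du : MDir} (hne : du ≠ rev δw) :
    Disjoint ((cellGeomSG₂bT G ψ P w₀ Λ b₀).Efar a' (w + stepVec δw) du) ((cellGeomSG₂bT G ψ P w₀ Λ b₀).Ewv a w δw) := by
  have h := P.EwvNS_disjoint_FarNS w hne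
  rw [PCells2T.EwvNS, Finset.disjoint_union_left] at h
  have hsub : P.FarNS₂ (w + stepVec δw) du ⊆ P.FarNS (w + stepVec δw) du := P.FarNS₂_subset_FarNS _ du
  change Disjoint (VWin G ψ w₀ (P.FarNS₂ (w + stepVec δw) du) (Λ.rE a' (w + stepVec δw) du))
    (VWin G ψ w₀ (P.BtwNS w δw) (Λ.rB a w δw) ∪ VWin G ψ w₀ (P.Q (w + stepVec δw)) (Λ.rQ a (w + stepVec δw)))
  rw [Finset.disjoint_union_right]
  exact ⟨disjoint_VWin (h.1.symm.mono_left hsub) _ _, disjoint_VWin (h.2.symm.mono_left hsub) _ _⟩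

include hΛ hb₀ hV hdu

/-- **Every `Dd ⊆ E^far_{a'}(x, du)` missing `Stub_j` is a subbox of `Wt` in the window graph of any depth `R ≥ rE_{a'}(x,du), rQ_a(x)`**
(from `Lip` of the cell map). [cite: KozmaNitzan2024, §4 p. 31 (D is a subbox of Ω)] -/
theorem isSubbox_Wt_fresh₂bT (hlip : Lip G ψ) {R : ℕ} (hE : Λ.rE a' (tgt e) du ≤ R) (hQ : Λ.rQ a (tgt e) ≤ R) {Dd : Finset V}
    (hDd : Dd ⊆ (⟨cellGeomSG₂bT G ψ P w₀ Λ b₀, p, δc⟩ : KSchA V ℕ).Γ.Efar a' (tgt e) du) (hdS : Disjoint Dd ((⟨cellGeomSG₂bT G ψ P w₀ Λ b₀, p, δc⟩ : KSchA V ℕ).Γ.Stub a' (tgt e) du j)) :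
    KNLevels.IsSubbox (winGraph G w₀ R) ((⟨cellGeomSG₂bT G ψ P w₀ Λ b₀, p, δc⟩ : KSchA V ℕ).Wt G h e a a' du j o) (⟨cellGeomSG₂bT G ψ P w₀ Λ b₀, p, δc⟩ : KSchA V ℕ).p Dd := by
  have hne : du ≠ rev e.2 := KSchA.du_ne_rev₂O hV hdu
  have hL := levelGeomSG₂bT P w₀ b₀ hΛ hlip hb₀
  refine Skel.isSubbox_Wt_winO G w₀ R hL (qSepGeomSG₂bT P w₀ b₀ hlip) hV hdu (b := a) (hDd.trans Finset.subset_union_right)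
    (fun u hu => by unfold KSchA.Sx; exact Finset.mem_union_right _ (hDd hu)) ?_ ?_ ?_
  · exact Finset.disjoint_union_right.2 ⟨(Efar₂_disjoint_Ewv'bT a a' e.1 hne).mono_left hDd, hdS⟩
  · intro u hu
    have hu' : u ∈ VWin G ψ w₀ (P.FarNS₂ (tgt e) du) (Λ.rE a' (tgt e) du) := hDd hu
    exact graphBall_mono G w₀ hE (mem_graphBall_of_mem_VWin hu')
  · intro v hv x hx hadj
    rcases Finset.mem_union.1 hx with hx | hx
    · rw [CellGeom.Ewv] at hx
      rcases Finset.mem_union.1 hx with hx | hx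
      · exact absurd hadj (hL.Btw_sep_Efar a a' e.1 e.2 du hne x hx v (hDd hv)).2
      · have hx' : x ∈ VWin G ψ w₀ (P.Q (e.1 + stepVec e.2)) (Λ.rQ a (e.1 + stepVec e.2)) := hx
        exact graphBall_mono G w₀ hQ (mem_graphBall_of_mem_VWin hx')
    · have hx' : x ∈ VWin G ψ w₀ (P.FarNS₂ (tgt e) du) (Λ.rE a' (tgt e) du) := hx
      exact graphBall_mono G w₀ hE (mem_graphBall_of_mem_VWin hx')

/-- **Every sub-region `Dd` of the cell-map face window `Win w₀ (farASS₂ x du j) rE` is a subbox of `Wt` in the window graph of depth `rE`** — no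
hypothesis on `rB`, `rQ`: nothing of `E_{w,v}` is `G`-adjacent to the window (from `Lip` and the weak steps of the cell map).
[cite: KozmaNitzan2024, §4 p. 31, p. 30 (Step III)] -/
theorem isSubbox_Wt_sub₂bT (hlip : Lip G ψ) (hws : WeakSteps G ψ) (hjK : j + 1 ≤ P.K) {Dd : Finset V}
    (hDd : Dd ⊆ Win G ψ w₀ (P.farASS₂ (tgt e) du j) (Λ.rE a' (tgt e) du)) :
    KNLevels.IsSubbox (winGraph G w₀ (Λ.rE a' (tgt e) du)) ((⟨cellGeomSG₂bT G ψ P w₀ Λ b₀, p, δc⟩ : KSchA V ℕ).Wt G h e a a' du j o) (⟨cellGeomSG₂bT G ψ P w₀ Λ b₀, p, δc⟩ : KSchA V ℕ).p Dd := by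
  have hne : du ≠ rev e.2 := KSchA.du_ne_rev₂O hV hdu
  have hL := levelGeomSG₂bT P w₀ b₀ hΛ hlip hb₀
  have hW : Win G ψ w₀ (P.farASS₂ (tgt e) du j) (Λ.rE a' (tgt e) du) ⊆ (cellGeomSG₂bT G ψ P w₀ Λ b₀).Efar a' (tgt e) du :=
    Win_farAS₂_subset_Efar_bT P w₀ b₀ hlip hws (le_trans (by omega) (hΛ.ρE1 a' (tgt e) du 0)) j
  have hDd' := hDd.trans hW
  refine Skel.isSubbox_Wt_winO G w₀ _ hL (qSepGeomSG₂bT P w₀ b₀ hlip) hV hdu (b := a) (hDd'.trans Finset.subset_union_right)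
    (fun u hu => by unfold KSchA.Sx; exact Finset.mem_union_right _ (hDd' hu)) ?_ (fun u hu => ((mem_Win G ψ).1 (hDd hu)).1) ?_
  · exact Finset.disjoint_union_right.2
      ⟨(disjoint_Win_farAS₂_Ewv_bT P w₀ b₀ a e.1 hne j _).mono_left hDd, (disjoint_Win_farAS₂_Stub_bT P w₀ b₀ a' (tgt e) du hjK _).mono_left hDd⟩
  · intro v hv x hx hadj
    rcases Finset.mem_union.1 hx with hx | hx
    · rw [CellGeom.Ewv] at hx
      rcases Finset.mem_union.1 hx with hx | hx
      · exact absurd hadj (hL.Btw_sep_Efar a a' e.1 e.2 du hne x hx v (hDd' hv)).2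
      · exact absurd hadj (sep_Q_Win_farAS₂_bT P w₀ b₀ hlip a (tgt e) du j _ x hx v (hDd hv)).2
    · have hx' : x ∈ VWin G ψ w₀ (P.FarNS₂ (tgt e) du) (Λ.rE a' (tgt e) du) := hx
      exact mem_graphBall_of_mem_VWin hx'

omit hV hdu hb₀ in
/-- A sub-region of the cell-map face window lies in the support `Sx = E_i ∪ E_{w,v} ∪ E^far` of `Wt` (from `Lip`, weak steps). [folklore] -/
theorem sub_subset_Sx₂bT (hlip : Lip G ψ) (hws : WeakSteps G ψ) {Dd : Finset V}
    (hDd : Dd ⊆ Win G ψ w₀ (P.farASS₂ (tgt e) du j) (Λ.rE a' (tgt e) du)) : Dd ⊆ (⟨cellGeomSG₂bT G ψ P w₀ Λ b₀, p, δc⟩ : KSchA V ℕ).Sx G h e a a' du := by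
  intro u hu
  unfold KSchA.Sx
  exact Finset.mem_union_right _ (Win_farAS₂_subset_Efar_bT P w₀ b₀ hlip hws (le_trans (by omega) (hΛ.ρE1 a' (tgt e) du 0)) j (hDd hu))

/-- The root lies off every sub-region of the cell-map face window (it is explored; the window is fresh). [folklore] -/
theorem root_not_mem_sub₂bT (hlip : Lip G ψ) (hws : WeakSteps G ψ) {Dd : Finset V}
    (hDd : Dd ⊆ Win G ψ w₀ (P.farASS₂ (tgt e) du j) (Λ.rE a' (tgt e) du)) : (⟨cellGeomSG₂bT G ψ P w₀ Λ b₀, p, δc⟩ : KSchA V ℕ).Γ.root ∉ Dd := by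
  exact KSchA.root_not_mem_of_freshO (levelGeomSG₂bT P w₀ b₀ hΛ hlip hb₀) (qSepGeomSG₂bT P w₀ b₀ hlip) hV hdu (a := a')
    ((hDd.trans (Win_farAS₂_subset_Efar_bT P w₀ b₀ hlip hws (le_trans (by omega) (hΛ.ρE1 a' (tgt e) du 0)) j)).trans Finset.subset_union_right)

/-! ## §2 Entrances into the maximal fresh region are deep; the rim excess of a sub-region -/

/-- **Entrances into `E^far ∖ Stub_j` are deep** (slack far region): a positive-weight edge of `Wt` from outside `E^far_{a'}(x,du) ∖ Stub_j` into it
starts in the cube span `Q_a(x)` or in the stub span, so it lands at depth `≤ R₀ + 1` once `R₀ ≥ rQ_a(x)` and `R₀ ≥ sup ρ_{a'}(x, du, ·)` (from `Lip`).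
[cite: KozmaNitzan2024, §4 pp. 26, 31] -/
theorem entrance_faceFresh₂bT (hlip : Lip G ψ) {R₀ : ℕ} (hQ : Λ.rQ a (tgt e) ≤ R₀) (hρ : ∀ ℓ, Λ.ρ a' (tgt e) du ℓ ≤ R₀) {y b : V}
    (hy : y ∉ (⟨cellGeomSG₂bT G ψ P w₀ Λ b₀, p, δc⟩ : KSchA V ℕ).Γ.Efar a' (tgt e) du \ (⟨cellGeomSG₂bT G ψ P w₀ Λ b₀, p, δc⟩ : KSchA V ℕ).Γ.Stub a' (tgt e) du j) (hb : b ∈ (⟨cellGeomSG₂bT G ψ P w₀ Λ b₀, p, δc⟩ : KSchA V ℕ).Γ.Efar a' (tgt e) du \ (⟨cellGeomSG₂bT G ψ P w₀ Λ b₀, p, δc⟩ : KSchA V ℕ).Γ.Stub a' (tgt e) du j)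
    (hadj : G.Adj y b) (hw : (⟨cellGeomSG₂bT G ψ P w₀ Λ b₀, p, δc⟩ : KSchA V ℕ).Wt G h e a a' du j o s(y, b) ≠ 0) : b ∈ graphBall G w₀ (R₀ + 1) := by
  have hne : du ≠ rev e.2 := KSchA.du_ne_rev₂O hV hdu
  have hL := levelGeomSG₂bT P w₀ b₀ hΛ hlip hb₀
  have hbE : b ∈ (cellGeomSG₂bT G ψ P w₀ Λ b₀).Efar a' (tgt e) du := (Finset.mem_sdiff.1 hb).1
  have hm : s(y, b) ∈ wireSet (↑(KSchA.Sx G ⟨cellGeomSG₂bT G ψ P w₀ Λ b₀, p, δc⟩ h e a a' du) : Set V) := by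
    by_contra hm; exact hw (KSchA.Wt_apply_of_not_mem_wireSet hm)
  have hyS : y ∈ KSchA.Sx G ⟨cellGeomSG₂bT G ψ P w₀ Λ b₀, p, δc⟩ h e a a' du := Finset.mem_coe.1 (mk_mem_wireSet_iff.1 hm).1
  unfold KSchA.Sx at hyS
  rcases Finset.mem_union.1 hyS with hyS | hyE
  · rcases Finset.mem_union.1 hyS with hyV | hyW
    · exact absurd hadj (KSchA.Valid₂O.sep_habitat hL (qSepGeomSG₂bT P w₀ b₀ hlip) hV hdu (a := a) (a' := a') y hyV b
        (Finset.mem_union_right _ hbE)).2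
    · rw [CellGeom.Ewv] at hyW
      rcases Finset.mem_union.1 hyW with hyB | hyQ
      · exact absurd hadj (hL.Btw_sep_Efar a a' e.1 e.2 du hne y hyB b hbE).2
      · have hyQ' : y ∈ VWin G ψ w₀ (P.Q (e.1 + stepVec e.2)) (Λ.rQ a (e.1 + stepVec e.2)) := hyQ
        exact mem_graphBall_succ_of_adj G (graphBall_mono G w₀ hQ (mem_graphBall_of_mem_VWin hyQ')) hadj
  · have hySt : y ∈ (cellGeomSG₂bT G ψ P w₀ Λ b₀).Stub a' (tgt e) du j := by
      by_contra h'; exact hy (Finset.mem_sdiff.2 ⟨hyE, h'⟩)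
    have hySt' : y ∈ VStair G ψ w₀ (P.Stub (tgt e) du j) (profT P Λ a' (tgt e) du) := hySt
    exact mem_graphBall_succ_of_adj G (graphBall_mono G w₀ (hρ _) (mem_of_mem_VStair hySt').2) hadj

/-- **The rim excess of a sub-region `Dd` of the cell-map face window is `≤ η`.**  With `Rim = {v ∈ Dd : v ∉ B_G(w₀, Rt − L')}`, an entrance depth
`R₀ ≥ rQ_a(x), sup ρ_{a'}(x,du,·)`, an excess radius `R₁ ≤ Rt − L'` at the running parameter for the PLANAR MAP `φ` (centre `w₀`, entrance depth
`R₀ + 1`, planar diameter `m`), and the planar diameter `m` of `E^far_{a'}(x,du)` under `φ`: `P_{Wt}(⋃_{t ∈ Rim} w₀ ↔ t) ≤ η`.  The habitat of the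
excess event is the maximal fresh region `E^far ∖ Stub_j` (from `Lip` and the weak steps of the cell map `ψ`).
[cite: KozmaNitzan2024, §4 Lemma 12 (p. 24)] [cite: MartineauSevero2019, Cor. 2.2] -/
theorem rim_excess_sub₂bT [Countable V] (hlip : Lip G ψ) (hws : WeakSteps G ψ) (hjK : j + 1 ≤ P.K) {R₀ : ℕ} (hQ : Λ.rQ a (tgt e) ≤ R₀)
    (hρ : ∀ ℓ, Λ.ρ a' (tgt e) du ℓ ≤ R₀) {φ : V → Site 2} {m Rt L' : ℕ} {η : ℝ} {R₁ : ℕ}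
    (hR₁ : ∀ R', R₁ ≤ R' → ∀ (Rw : ℕ) (D' A' : Finset V), (∀ d ∈ D', d ∈ graphBall G w₀ Rw) →
      (∀ d ∈ D', ∀ d' ∈ D', φ d - φ d' ∈ box 2 m) → A' ⊆ D' → (∀ a ∈ A', a ∈ graphBall G w₀ (R₀ + 1)) →
        (bondPercolation G p).real (excess G w₀ R' D' A') ≤ η)
    (hR : R₁ ≤ Rt - L') (hdiam : ∀ d ∈ (⟨cellGeomSG₂bT G ψ P w₀ Λ b₀, p, δc⟩ : KSchA V ℕ).Γ.Efar a' (tgt e) du, ∀ d' ∈ (⟨cellGeomSG₂bT G ψ P w₀ Λ b₀, p, δc⟩ : KSchA V ℕ).Γ.Efar a' (tgt e) du, φ d - φ d' ∈ box 2 m) {Dd : Finset V}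
    (hDd : Dd ⊆ Win G ψ w₀ (P.farASS₂ (tgt e) du j) (Λ.rE a' (tgt e) du)) :
    (prodBernoulli ((⟨cellGeomSG₂bT G ψ P w₀ Λ b₀, p, δc⟩ : KSchA V ℕ).Wt G h e a a' du j o)).real
      (⋃ t ∈ Dd.filter (fun v => v ∉ graphBall G w₀ (Rt - L')), openConn w₀ t) ≤ η := by
  have hdiam' := hdiam
  set R := max (Λ.rE a' (tgt e) du) (Λ.rQ a (tgt e)) with hRdef
  set D : Finset V := (cellGeomSG₂bT G ψ P w₀ Λ b₀).Efar a' (tgt e) du \ (cellGeomSG₂bT G ψ P w₀ Λ b₀).Stub a' (tgt e) du j with hD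
  have hDE : D ⊆ (cellGeomSG₂bT G ψ P w₀ Λ b₀).Efar a' (tgt e) du := Finset.sdiff_subset
  have hDE' : D ⊆ VWin G ψ w₀ (P.FarNS₂ (tgt e) du) (Λ.rE a' (tgt e) du) := hDE
  have hWD := isSubbox_Wt_fresh₂bT hΛ hb₀ hV hdu (j := j) (o := o) hlip
    (show Λ.rE a' (tgt e) du ≤ R from le_max_left _ _) (show Λ.rQ a (tgt e) ≤ R from le_max_right _ _) hDE Finset.sdiff_disjoint
  have hA : ∀ y b, y ∉ D → b ∈ D → G.Adj y b → KSchA.Wt G ⟨cellGeomSG₂bT G ψ P w₀ Λ b₀, p, δc⟩ h e a a' du j o s(y, b) ≠ 0 →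
      b ∈ graphBall G w₀ (R₀ + 1) :=
    fun y b hy hb hadj hw => entrance_faceFresh₂bT hΛ hb₀ hV hdu hlip hQ hρ hy hb hadj hw
  have hRg : Dd ⊆ D := fun u hu =>
    Finset.mem_sdiff.2 ⟨Win_farAS₂_subset_Efar_bT P w₀ b₀ hlip hws (le_trans (by omega) (hΛ.ρE1 a' (tgt e) du 0)) j (hDd hu),
      Finset.disjoint_left.1 (disjoint_Win_farAS₂_Stub_bT P w₀ b₀ a' (tgt e) du hjK _) (hDd hu)⟩
  have hDπ : ∀ v ∈ D, v ∈ graphBall G w₀ R := fun v hv =>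
    graphBall_mono G w₀ (le_max_left _ _) (mem_graphBall_of_mem_VWin (hDE' hv))
  have hroot : w₀ ∉ D := KSchA.root_not_mem_of_freshO 
    (levelGeomSG₂bT P w₀ b₀ hΛ hlip hb₀) (qSepGeomSG₂bT P w₀ b₀ hlip) hV hdu (a := a) (hDE.trans Finset.subset_union_right)
  exact real_rim_le_of_radius hWD hDπ (fun e' he' => KSchA.Wt_eq_zero_of_not_mem_edgeSet he') hroot
    ((Finset.filter_subset _ _).trans hRg) (fun t ht => (Finset.mem_filter.1 ht).2) hA hR₁ hR
    (Rw := Λ.rE a' (tgt e) du) (fun d hd => mem_graphBall_of_mem_VWin (hDE' hd)) fun d hd d' hd' => hdiam' d (hDE hd) d' (hDE hd')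

end Skelφ

end Summit.CriticalPhenomena.PercolationContinuityZ3.Theorems.Transplant

end
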